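import Literature.MathematicalPhysics.QuantumFieldTheory.WilsonFinTorusTwistedPartition
import Summits.QuantumFields.YangMills.Cruxes.IR.Lines.flux_purity_split
import HarnessLib

/-!
# ANOMALY SHEET (ym-ir-idea-29 g0, lens «anomaly»): the typed form of the PRE-REGISTERED structural tests S-P4 of
`Cruxes/IRcof/ANOMALY-CENSUS-ym-ir-idea-29-g0.md` §3 — NOT filed, NOT claimed; typed only so that, if the
TABLE-E2-Q3 rows fire, the crux idea names an elaborating statement.  Nothing here bears on the Clay problem.

* `TwistSupermodular` — 't Hooft's temporally twisted Wilson partition function of the box `L³ × t` is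
  SUPERMODULAR in two ORTHOGONAL temporal planes: `Z(c on (0,3)) · Z(c' on (1,3)) ≤ Z(c on (0,3) and c' on (1,3)) · Z`.
  (Parallel composition is reflection positivity — tree `ElectricFluxPositivity`; orthogonal planes carry no RP
  relation; 2D/3D-Ising tower exact checks: always true on the computed tori.)
* `SingleTwistFluxControl` — the consequence used toward the F-half of per-box purity: the vacuum electric-flux
  weight is bounded below by the ONE-plane twist ratio alone, `w₀ ≥ ((1 + r₁)/2)³` (ℤ₂-type central twists).
-/

namespace Summit.QuantumFields.YangMills.Cruxes.IRcof.AnomalySheet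

open MeasureTheory Literature.MathematicalPhysics.QuantumFieldTheory

/-- The twist assigning the central element `c` to the temporal planes `(μ,3)` with `k μ = true` (`μ < 3`). -/
def twistOf {G : Type} [Group G] (c : G) (k : Fin 3 → Bool) : Fin 4 → G :=
  fun μ => if h : (μ : ℕ) < 3 then (if k ⟨μ, h⟩ then c else 1) else 1

/-- S-P4 typed: supermodularity of the temporally twisted partition function in two orthogonal temporal planes,
for every compact group, continuous unitary-free matrix representation, `β ≥ 0`, central `c, c'`, every box `L³ × t`. -/
def TwistSupermodular : Prop :=
  ∀ (G : Type) [Group G] [TopologicalSpace G] [IsTopologicalGroup G] [CompactSpace G] [MeasurableSpace G]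
    [BorelSpace G] (n : ℕ) (ρ : G →* Matrix (Fin n) (Fin n) ℂ), Continuous ρ →
    ∀ β : ℝ, 0 ≤ β → ∀ c c' : G, c ∈ Subgroup.center G → c' ∈ Subgroup.center G →
    ∀ L t : ℕ,
      wilsonFinTorusTwistedPartition ρ β (Function.update (1 : Fin 4 → G) 0 c) L L L t *
          wilsonFinTorusTwistedPartition ρ β (Function.update (1 : Fin 4 → G) 1 c') L L L t ≤
        wilsonFinTorusTwistedPartition ρ β (Function.update (Function.update (1 : Fin 4 → G) 0 c) 1 c') L L L t *
          wilsonFinTorusTwistedPartition ρ β (1 : Fin 4 → G) L L L t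

/-- T_P4⁺ typed: single-plane control of the vacuum electric-flux weight.  With `Z_k := Z(twistOf c k)` over the
eight ℤ₂-type temporal twists (`c` central, `c * c = 1`) and `w₀ := (Σ_k Z_k) / (8 Z)`, `r₁ := Z(c on (0,3)) / Z`:
`w₀ ≥ ((1 + r₁)/2)³`, stated multiplied through by `8 Z⁴ > 0`-free form `8 Z³ Σ_k Z_k ≥ … ` avoided — ratio form. -/
def SingleTwistFluxControl : Prop :=
  ∀ (G : Type) [Group G] [TopologicalSpace G] [IsTopologicalGroup G] [CompactSpace G] [MeasurableSpace G]
    [BorelSpace G] (n : ℕ) (ρ : G →* Matrix (Fin n) (Fin n) ℂ), Continuous ρ →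
    ∀ β : ℝ, 0 ≤ β → ∀ c : G, c ∈ Subgroup.center G → c * c = 1 →
    ∀ L t : ℕ, 2 ≤ L → 2 ≤ t →
      ((1 + wilsonFinTorusTwistedPartition ρ β (Function.update (1 : Fin 4 → G) 0 c) L L L t /
              wilsonFinTorusTwistedPartition ρ β (1 : Fin 4 → G) L L L t) / 2) ^ 3 ≤
        (∑ k : Fin 3 → Bool, wilsonFinTorusTwistedPartition ρ β (twistOf c k) L L L t) /
          (8 * wilsonFinTorusTwistedPartition ρ β (1 : Fin 4 → G) L L L t)

/-- F restricted to ONE temporal plane class: every SINGLE-plane central twist `update 1 μ c` is `ε`-invisible in the cold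
4:1 boxes (verbatim `ConfinedTemporalTwistSC` of `Cruxes/IR/Lines/flux_purity_split.lean` with `z` specialised). -/
def ConfinedSinglePlaneTwistSC : Prop :=
  ∀ (G : Type) [Group G] [TopologicalSpace G] [IsTopologicalGroup G] [CompactSpace G],
    IsCompactSimpleLieGroup G → SimplyConnectedSpace G →
    letI : MeasurableSpace G := borel G
    haveI : BorelSpace G := ⟨rfl⟩
    ∀ r : LatticeRep G, ∀ ε : ℝ, 0 < ε → ∃ β₁ : ℝ, ∀ β : ℝ, β₁ ≤ β → ∃ L₁ : ℕ, ∀ L : ℕ, L₁ ≤ L →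
      ∀ (μ : Fin 4) (c : G), c ∈ Subgroup.center G → ∀ t : ℕ, (t = L / 4 ∨ t = 2 * (L / 4)) →
        |Summit.QuantumFields.YangMills.Cruxes.IR.FluxPuritySplit.twistedColdZ r.ρ β (Function.update 1 μ c) L t -
            wilsonFinTorusPartition r.ρ β L L L t| ≤ ε * wilsonFinTorusPartition r.ρ β L L L t

/-- R2, the composition BY NAME (statement only; the proof is bookkeeping: `r(z₀z₁z₂) ≥ r(z₀)r(z₁)r(z₂) ≥ (1−ε)³` by
`TwistSupermodular` twice, `≤ 1` by domination): one-plane confinement of temporal twist suffices for idea-10's `F`. -/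
def SinglePlaneSuffices : Prop :=
  TwistSupermodular → ConfinedSinglePlaneTwistSC →
    Summit.QuantumFields.YangMills.Cruxes.IR.FluxPuritySplit.ConfinedTemporalTwistSC

end Summit.QuantumFields.YangMills.Cruxes.IRcof.AnomalySheet
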